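import Summits.Ventures.YMGap.Thresholds.OneLinkVarianceSD
import HarnessLib

/-!
# Venture YMGap — the CENTRED Schwinger–Dyson variance of the one-link linear statistic (`E|z − Ez|²` instead of `E|z|²`),
# hypothesis-free for every `SU(N)`, and the modulus `K_PV2(N,R;τ) = √((τ + τ³N²R²/(16(τ−1)))/(1/2 − R))`

HONEST FRAMING.  Venture file of the cell `pub-ymgap` (QuantumFields programme), seat engine-2 (g10); 0 compute.  Explicit
STRONG-COUPLING constants for ONE tilted Haar law on `SU(N)` (small-`β` bookkeeping for lattice Yang–Mills); NOT weak coupling,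
NOT a continuum statement, NOT a Yang–Mills mass-gap claim.  One new elementary step (an S-lemma elimination of the mean);
everything else composes theorems already in the tree.

THE OBSERVATION.  `ν_B(dg) ∝ exp(N Re tr(gB)) dg` on `SU(N)`, `z(g) = tr(gM)`.  p2's Schwinger–Dyson identity
(`OneLinkSDMeans.integral_reTrProdConj_eq` + `OneLinkFeedback.Gam_potB_reTrProdConj`) reads
`E|z|² = ‖M‖_F²/N + ½ E(Re[z̄·tr(MBᴴ)] − Re[z̄·tr(BgMg)])`.  The first word is LINEAR in `z̄`: it integrates to
`Re[conj(E z)·tr(MBᴴ)] ≤ |E z|·|tr(MBᴴ)|` — the MEAN, not the second moment (g9's `oneLinkVarianceBound_sd` and p2's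
`sqrt_integral_normSq_trace_le_sd` bound it by `√E|z|²`).  With `m = |E z|`, `Z = √E|z|²`, `t ≥ |tr(MBᴴ)|`,
`W ≥ ‖tr(gMgB)‖_{L²(ν_B)}` (Cauchy–Schwarz on the second word): `Z² ≤ ‖M‖_F²/N + (t/2)m + (W/2)Z`, and the CENTRED second
moment `E|z − Ez|² = Z² − m²` follows by eliminating `(m, Z)` with one multiplier `τ > 1`:
`Z² − m² ≤ τ‖M‖_F²/N + τ²t²/16 + τ²W²/(16(τ−1))`.  With `t, W ≤ ‖B‖_F‖M‖_F ≤ √N‖B‖_op‖M‖_F`: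
* `integral_normSq_sub_le_sd_centred` (every `N ≥ 1`, `B`, `M`, `τ > 1`; PARAMETRIC in `t`, `W` — p2's `L²` size of the quadratic
  word, `OneLinkSDQuadScale`, can be substituted for `W`); `integral_normSq_sub_le_sd_centred_frob` (`t = W = ‖B‖_F‖M‖_F`);
* `oneLinkVarianceBound_sdc` (K, every `N ≥ 1`, `R`, `τ > 1`): `OneLinkVarianceBound N R (N(τ + τ³N²R²/(16(τ−1))))` — to first
  order in `R` this is `N(1 + NR/2)` (optimal `τ`) against `N(1 + NR)` uncentred; `SU(3)`: `R = 1/4`: `4.51` (uncentred `6.25`,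
  Bakry–Émery `12`), `R = 11/30`: `5.53` (`8.58`, `22.5`; the CERTIFIED H2 reads `2.45`; Haar `3/2`);
* `oneLinkKRModulus_pv2` (K, `N ≥ 2`, `R < 1/2`, `τ > 1`): `OneLinkKRModulus N R √((τ + τ³N²R²/(16(τ−1)))/(1/2 − R))` through
  pub-balaban's door `√(c·v)` with Bakry–Émery's `c = 1/(N(1/2 − R))`; rational envelope `oneLinkKRModulus_pv2_of_le`; `SU(3)`
  literal forms `su3_oneLinkVarianceBound_sdc_of_le`, `su3_oneLinkKRModulus_pv2_of_le` (instances: the row files).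
WHAT IT BUYS (exact certificates `HOME/pub-ymgap-engine-2/pv2/cert_pv2.json`; `N = 3`, `τ ≈ 1.06–1.3`): `K_PV2` vs g9's `K_PV`:
`R = 1/5`: `2.144` vs `2.454`; `1/4`: `2.451` vs `2.886`; `3/10`: `2.861` vs `3.458`; `11/30`: `3.716` vs `4.632` (`−13 … −20 %`).
NOT CLAIMED: anything for `SU(2)` (the quarter modulus is better); any improvement of the CERTIFIED `SU(3)` column (`7/5`); sharpness.

References: H. Shen, R. Zhu, X. Zhu, CMP 400 (2023) 805–851 (arXiv:2204.12737), Lemma 4.1, Rem. 1.3 (Bakry–Émery on `SU(N)`);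
H. Föllmer, LNM 1362 (1988) Thm. (2.13); cell notes `HOME/p2/ONE-LINK-HIERARCHY.md` §4, `HOME/pub-ymgap-engine-2/PV2-CENTRED.md`.
-/
noncomputable section

open scoped Matrix ComplexConjugate BigOperators Matrix.Norms.Frobenius
open Matrix Complex MeasureTheory ProbabilityTheory
open Literature.MathematicalPhysics.QuantumFieldTheory
open Literature.MathematicalPhysics.QuantumFieldTheory.SUNBakryEmery
open Literature.MathematicalPhysics.QuantumFieldTheory.Balaban1983to89.StrongCouplingDobrushinWindow (OneLinkKRModulus)
open Summit.QuantumFields.BalabanUV.InfraRed.StrongCouplingVarianceDoorSUN (OneLinkVarianceBound)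
open Summit.QuantumFields.BalabanUV.InfraRed.StrongCouplingPoincareDoorSUN
  (OneLinkPoincareSUN oneLinkPoincareSUN_bakryEmery oneLinkKRModulus_of_poincare_of_varianceBound)
open Summit.Ventures.YMGap.OneLinkEigen (integral_reTrProdConj_eq Gam_potB_reTrProdConj norm_trace_mul_le
  frobNorm_le_sqrt_mul_matrixOpNorm)
open Summit.Ventures.YMGap.StarSUN (oneLinkKRModulus_mono_const)

namespace Summit.Ventures.YMGap.OneLinkVarianceSDC

variable {N : ℕ}

/-! ### 1. The S-lemma elimination of the mean -/

/-- **S-lemma step**: from `Z² ≤ c + (t/2)·m + (W/2)·Z` and a multiplier `τ > 1`,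
`Z² − m² ≤ τc + τ²t²/16 + τ²W²/(16(τ−1))` (complete the two squares `−(τ−1)Z² + (τW/2)Z`, `−m² + (τt/2)m`). [folklore] -/
theorem sq_sub_sq_le_of_slemma {Z m c t W τ : ℝ} (hτ : 1 < τ) (h : Z ^ 2 ≤ c + t / 2 * m + W / 2 * Z) :
    Z ^ 2 - m ^ 2 ≤ τ * c + τ ^ 2 * t ^ 2 / 16 + τ ^ 2 * W ^ 2 / (16 * (τ - 1)) := by
  have h1 : 0 < τ - 1 := by linarith
  have k1 : -(τ - 1) * Z ^ 2 + τ * W / 2 * Z ≤ τ ^ 2 * W ^ 2 / (16 * (τ - 1)) := by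
    rw [le_div_iff₀ (by positivity)]
    nlinarith [sq_nonneg (4 * (τ - 1) * Z - τ * W)]
  have k2 : -m ^ 2 + τ * t / 2 * m ≤ τ ^ 2 * t ^ 2 / 16 := by nlinarith [sq_nonneg (4 * m - τ * t)]
  have k3 : τ * Z ^ 2 ≤ τ * (c + t / 2 * m + W / 2 * Z) := mul_le_mul_of_nonneg_left h (by linarith)
  nlinarith [k1, k2, k3]

/-! ### 2. The centred Schwinger–Dyson second moment -/

/-- **THE CENTRED SCHWINGER–DYSON SECOND MOMENT, every `SU(N)`, `N ≥ 1`, every `B`, `M`, every multiplier `τ > 1`**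
(parametric form): if `|tr(M Bᴴ)| ≤ t` and `√(E_{ν_B}|tr(gMgB)|²) ≤ W`, then
`E_{ν_B}|tr(gM)|² − |E_{ν_B} tr(gM)|² ≤ τ‖M‖_F²/N + τ²t²/16 + τ²W²/(16(τ−1))`.  Proof: p2's identity
`E|z|² = ‖M‖_F²/N + ½E(Re[z̄ tr(MBᴴ)] − Re[z̄ tr(BgMg)])`, the first word integrates to `Re[conj(Ez)·tr(MBᴴ)] ≤ |Ez|·t`, the
second is at most `Z·W` by Cauchy–Schwarz, then `sq_sub_sq_le_of_slemma`. [folklore] -/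
theorem integral_normSq_sub_le_sd_centred (hN : N ≠ 0) (B M : Matrix (Fin N) (Fin N) ℂ) {τ t W : ℝ} (hτ : 1 < τ)
    (ht : ‖(M * Bᴴ).trace‖ ≤ t)
    (hW : Real.sqrt (∫ g, ‖((g : Matrix (Fin N) (Fin N) ℂ) * M * (g : Matrix (Fin N) (Fin N) ℂ) * B).trace‖ ^ 2
        ∂(haarProbability (SUN N)).tilted (fun g => (N : ℝ) * ((g : Matrix (Fin N) (Fin N) ℂ) * B).trace.re)) ≤ W) :
    ∫ g, ‖((g : Matrix (Fin N) (Fin N) ℂ) * M).trace‖ ^ 2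
        ∂(haarProbability (SUN N)).tilted (fun g => (N : ℝ) * ((g : Matrix (Fin N) (Fin N) ℂ) * B).trace.re) -
      ‖∫ g, ((g : Matrix (Fin N) (Fin N) ℂ) * M).trace
        ∂(haarProbability (SUN N)).tilted (fun g => (N : ℝ) * ((g : Matrix (Fin N) (Fin N) ℂ) * B).trace.re)‖ ^ 2 ≤
      τ * frobNorm M ^ 2 / N + τ ^ 2 * t ^ 2 / 16 + τ ^ 2 * W ^ 2 / (16 * (τ - 1)) := by
  have hNpos : (0 : ℝ) < N := Nat.cast_pos.2 (Nat.pos_of_ne_zero hN)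
  set ν : Measure (SUN N) := (haarProbability (SUN N)).tilted
      (fun g => (N : ℝ) * ((g : Matrix (Fin N) (Fin N) ℂ) * B).trace.re) with hν
  have hexpi : Integrable (fun g : SUN N => Real.exp ((N : ℝ) * ((g : Matrix (Fin N) (Fin N) ℂ) * B).trace.re))
      (haarProbability (SUN N)) :=
    integrable_of_continuous_SUN (Real.continuous_exp.comp (continuous_restrict (contDiff_pot (N : ℝ) B))) _
  haveI : IsProbabilityMeasure ν := isProbabilityMeasure_tilted hexpi
  -- the statistic `z`, the quadratic word `w`, their continuity
  have hzc' : Continuous fun g : SUN N => ((g : Matrix (Fin N) (Fin N) ℂ) * M).trace :=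
    (continuous_subtype_val.matrix_mul continuous_const).matrix_trace
  have hwc' : Continuous fun g : SUN N => ((g : Matrix (Fin N) (Fin N) ℂ) * M * (g : Matrix (Fin N) (Fin N) ℂ) * B).trace :=
    (((continuous_subtype_val.matrix_mul continuous_const).matrix_mul continuous_subtype_val).matrix_mul
      continuous_const).matrix_trace
  have hzn := continuous_norm.comp hzc'
  have hwn := continuous_norm.comp hwc'
  have hzi : Integrable (fun g : SUN N => ((g : Matrix (Fin N) (Fin N) ℂ) * M).trace) ν :=
    hzc'.integrable_of_hasCompactSupport (HasCompactSupport.of_compactSpace _)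
  set S : ℝ := ∫ g, ‖((g : Matrix (Fin N) (Fin N) ℂ) * M).trace‖ ^ 2 ∂ν with hS
  set μz : ℂ := ∫ g, ((g : Matrix (Fin N) (Fin N) ℂ) * M).trace ∂ν with hμz
  set T : ℂ := (M * Bᴴ).trace with hT
  set Z : ℝ := Real.sqrt S with hZ
  have hZ0 : 0 ≤ Z := Real.sqrt_nonneg _
  have hZZ : Z ^ 2 = S := Real.sq_sqrt (integral_nonneg fun g => sq_nonneg _)
  -- (1) `∫ ‖z‖‖w‖ ≤ Z W`
  have hzw : ∫ g, ‖((g : Matrix (Fin N) (Fin N) ℂ) * M).trace‖ *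
      ‖((g : Matrix (Fin N) (Fin N) ℂ) * M * (g : Matrix (Fin N) (Fin N) ℂ) * B).trace‖ ∂ν ≤ Z * W := by
    exact (le_abs_self _).trans ((abs_integral_mul_le_sqrt hzn hwn ν).trans (mul_le_mul_of_nonneg_left hW hZ0))
  -- (2) the Schwinger–Dyson identity `S = ‖M‖²/N + ½ ∫ Γ`
  have hI := integral_reTrProdConj_eq hN B M M (N := N)
  rw [← hν] at hI
  have eS : S = ∫ g, (((g : Matrix (Fin N) (Fin N) ℂ) * M).trace *
      (starRingEnd ℂ) ((g : Matrix (Fin N) (Fin N) ℂ) * M).trace).re ∂ν := by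
    rw [hS]
    refine integral_congr_ae (Filter.Eventually.of_forall fun g => ?_)
    simp only [Complex.mul_conj, Complex.ofReal_re, Complex.normSq_eq_norm_sq]
  have eMM : (M * Mᴴ).trace.re = frobNorm M ^ 2 := by
    rw [frobNorm_sq_eq_re_trace, Matrix.trace_mul_comm]
  -- (3) the feedback `Γ = −A + C` with `A = Re[z̄ w']`, `C = Re[z̄ T]`
  set A : SUN N → ℝ := fun g => ((starRingEnd ℂ) ((g : Matrix (Fin N) (Fin N) ℂ) * M).trace *
      (B * (g : Matrix (Fin N) (Fin N) ℂ) * M * (g : Matrix (Fin N) (Fin N) ℂ)).trace).re with hA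
  set C : SUN N → ℝ := fun g => ((starRingEnd ℂ) ((g : Matrix (Fin N) (Fin N) ℂ) * M).trace * T).re with hC
  have hGam : ∀ g : SUN N,
      Gam (pot 1 B) (fun Q : Matrix (Fin N) (Fin N) ℂ => ((Q * M).trace * (starRingEnd ℂ) (Q * M).trace).re) g =
        C g - A g := by
    intro g
    rw [Gam_potB_reTrProdConj hN B M M g]
    simp only [hA, hC, hT]
    ring
  have hAc : Continuous A := by
    have hw2 : Continuous fun g : SUN N =>
        (B * (g : Matrix (Fin N) (Fin N) ℂ) * M * (g : Matrix (Fin N) (Fin N) ℂ)).trace :=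
      (((continuous_const.matrix_mul continuous_subtype_val).matrix_mul continuous_const).matrix_mul
        continuous_subtype_val).matrix_trace
    exact Complex.continuous_re.comp ((Complex.continuous_conj.comp hzc').mul hw2)
  have hCc : Continuous C :=
    Complex.continuous_re.comp ((Complex.continuous_conj.comp hzc').mul continuous_const)
  have iA : Integrable A ν := integrable_of_continuous_SUN hAc ν
  have iC : Integrable C ν := integrable_of_continuous_SUN hCc ν
  have hintGam : ∫ g, Gam (pot 1 B) (fun Q : Matrix (Fin N) (Fin N) ℂ =>
      ((Q * M).trace * (starRingEnd ℂ) (Q * M).trace).re) g ∂ν = ∫ g, C g ∂ν - ∫ g, A g ∂ν := by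
    rw [integral_congr_ae (Filter.Eventually.of_forall hGam), integral_sub iC iA]
  -- (4) `|A| ≤ ‖z‖‖w‖` pointwise (cyclicity `tr(BgMg) = tr(gMgB)`), hence `−∫A ≤ Z W`
  have hAle : ∀ g : SUN N, |A g| ≤ ‖((g : Matrix (Fin N) (Fin N) ℂ) * M).trace‖ *
      ‖((g : Matrix (Fin N) (Fin N) ℂ) * M * (g : Matrix (Fin N) (Fin N) ℂ) * B).trace‖ := by
    intro g
    have ecyc : (B * (g : Matrix (Fin N) (Fin N) ℂ) * M * (g : Matrix (Fin N) (Fin N) ℂ)).trace =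
        ((g : Matrix (Fin N) (Fin N) ℂ) * M * (g : Matrix (Fin N) (Fin N) ℂ) * B).trace := by
      rw [show B * (g : Matrix (Fin N) (Fin N) ℂ) * M * (g : Matrix (Fin N) (Fin N) ℂ) =
          B * ((g : Matrix (Fin N) (Fin N) ℂ) * M * (g : Matrix (Fin N) (Fin N) ℂ)) by simp only [Matrix.mul_assoc],
        Matrix.trace_mul_comm]
    simp only [hA]
    rw [ecyc]
    refine (Complex.abs_re_le_norm _).trans ?_
    rw [norm_mul, Complex.norm_conj]
  have hintA : -∫ g, A g ∂ν ≤ Z * W := by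
    have h1 : |∫ g, A g ∂ν| ≤ Z * W := by
      calc |∫ g, A g ∂ν| ≤ ∫ g, |A g| ∂ν := abs_integral_le_integral_abs
        _ ≤ ∫ g, ‖((g : Matrix (Fin N) (Fin N) ℂ) * M).trace‖ *
            ‖((g : Matrix (Fin N) (Fin N) ℂ) * M * (g : Matrix (Fin N) (Fin N) ℂ) * B).trace‖ ∂ν :=
            integral_mono iA.abs (integrable_of_continuous_SUN (hzn.mul hwn) ν) hAle
        _ ≤ Z * W := hzw
    linarith [neg_abs_le (∫ g, A g ∂ν)]
  -- (5) `∫ C = Re[conj(E z) T] ≤ ‖E z‖ t`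
  have hintC : ∫ g, C g ∂ν = ((starRingEnd ℂ) μz * T).re := by
    have e1 : ∫ g, C g ∂ν = ∫ g, (((g : Matrix (Fin N) (Fin N) ℂ) * M).trace.re * T.re +
        ((g : Matrix (Fin N) (Fin N) ℂ) * M).trace.im * T.im) ∂ν :=
      integral_congr_ae (Filter.Eventually.of_forall fun g => by
        simp only [hC, Complex.mul_re, Complex.conj_re, Complex.conj_im]; ring)
    have ire : Integrable (fun g : SUN N => ((g : Matrix (Fin N) (Fin N) ℂ) * M).trace.re) ν :=
      integrable_of_continuous_SUN (Complex.continuous_re.comp hzc') ν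
    have iim : Integrable (fun g : SUN N => ((g : Matrix (Fin N) (Fin N) ℂ) * M).trace.im) ν :=
      integrable_of_continuous_SUN (Complex.continuous_im.comp hzc') ν
    have hre : ∫ g, ((g : Matrix (Fin N) (Fin N) ℂ) * M).trace.re ∂ν = μz.re := by
      simpa only [RCLike.re_to_complex] using integral_re hzi
    have him : ∫ g, ((g : Matrix (Fin N) (Fin N) ℂ) * M).trace.im ∂ν = μz.im := by
      simpa only [RCLike.im_to_complex] using integral_im hzi
    rw [e1, integral_add (ire.mul_const T.re) (iim.mul_const T.im), integral_mul_const, integral_mul_const, hre, him]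
    simp only [Complex.mul_re, Complex.conj_re, Complex.conj_im]; ring
  have ht0 : 0 ≤ t := (norm_nonneg _).trans ht
  have hCle : ∫ g, C g ∂ν ≤ ‖μz‖ * t := by
    rw [hintC]
    refine (Complex.re_le_norm _).trans ?_
    rw [norm_mul, Complex.norm_conj]
    exact mul_le_mul_of_nonneg_left ht (norm_nonneg _)
  -- (6) the quadratic inequality `Z² ≤ ‖M‖²/N + (t/2)‖Ez‖ + (W/2) Z` and the S-lemma
  have hquad : Z ^ 2 ≤ frobNorm M ^ 2 / N + t / 2 * ‖μz‖ + W / 2 * Z := by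
    rw [hZZ, eS, hI, eMM, hintGam]
    nlinarith [hintA, hCle]
  have h := sq_sub_sq_le_of_slemma hτ hquad
  rw [hZZ] at h
  refine h.trans (le_of_eq ?_)
  ring

/-- **Frobenius form**: for every `B`, `M`, `N ≥ 1`, `τ > 1`,
`E_{ν_B}|tr(gM)|² − |E_{ν_B} tr(gM)|² ≤ τ‖M‖_F²/N + τ³‖B‖_F²‖M‖_F²/(16(τ−1))` (both words at their pointwise size
`‖B‖_F‖M‖_F`). [folklore] -/
theorem integral_normSq_sub_le_sd_centred_frob (hN : N ≠ 0) (B M : Matrix (Fin N) (Fin N) ℂ) {τ : ℝ} (hτ : 1 < τ) :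
    ∫ g, ‖((g : Matrix (Fin N) (Fin N) ℂ) * M).trace‖ ^ 2
        ∂(haarProbability (SUN N)).tilted (fun g => (N : ℝ) * ((g : Matrix (Fin N) (Fin N) ℂ) * B).trace.re) -
      ‖∫ g, ((g : Matrix (Fin N) (Fin N) ℂ) * M).trace
        ∂(haarProbability (SUN N)).tilted (fun g => (N : ℝ) * ((g : Matrix (Fin N) (Fin N) ℂ) * B).trace.re)‖ ^ 2 ≤
      τ * frobNorm M ^ 2 / N + τ ^ 3 * (frobNorm B * frobNorm M) ^ 2 / (16 * (τ - 1)) := by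
  set ν : Measure (SUN N) := (haarProbability (SUN N)).tilted
      (fun g => (N : ℝ) * ((g : Matrix (Fin N) (Fin N) ℂ) * B).trace.re) with hν
  have hexpi : Integrable (fun g : SUN N => Real.exp ((N : ℝ) * ((g : Matrix (Fin N) (Fin N) ℂ) * B).trace.re))
      (haarProbability (SUN N)) :=
    integrable_of_continuous_SUN (Real.continuous_exp.comp (continuous_restrict (contDiff_pot (N : ℝ) B))) _
  haveI : IsProbabilityMeasure ν := isProbabilityMeasure_tilted hexpi
  have hB0 := frobNorm_nonneg B
  have hM0 := frobNorm_nonneg M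
  set b : ℝ := frobNorm B * frobNorm M with hb
  have hb0 : 0 ≤ b := mul_nonneg hB0 hM0
  -- `|tr(M Bᴴ)| ≤ b`
  have ht : ‖(M * Bᴴ).trace‖ ≤ b := by
    refine (norm_trace_mul_le _ _).trans ?_
    rw [frobNorm_conjTranspose, hb, mul_comm]
  -- `√E|tr(gMgB)|² ≤ b` from the pointwise bound
  have hw : ∀ g : SUN N, ‖((g : Matrix (Fin N) (Fin N) ℂ) * M * (g : Matrix (Fin N) (Fin N) ℂ) * B).trace‖ ≤ b := by
    intro g
    have hg := SUN.mem_unitaryGroup g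
    rw [show (g : Matrix (Fin N) (Fin N) ℂ) * M * (g : Matrix (Fin N) (Fin N) ℂ) * B =
        ((g : Matrix (Fin N) (Fin N) ℂ) * M) * ((g : Matrix (Fin N) (Fin N) ℂ) * B) by simp only [Matrix.mul_assoc]]
    refine (norm_trace_mul_le _ _).trans ?_
    rw [frobNorm_unitary_mul hg, frobNorm_unitary_mul hg, hb, mul_comm]
  have hwc : Continuous fun g : SUN N =>
      ‖((g : Matrix (Fin N) (Fin N) ℂ) * M * (g : Matrix (Fin N) (Fin N) ℂ) * B).trace‖ ^ 2 :=
    (continuous_norm.comp ((((continuous_subtype_val.matrix_mul continuous_const).matrix_mul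
      continuous_subtype_val).matrix_mul continuous_const).matrix_trace)).pow 2
  have hW : Real.sqrt (∫ g, ‖((g : Matrix (Fin N) (Fin N) ℂ) * M * (g : Matrix (Fin N) (Fin N) ℂ) * B).trace‖ ^ 2 ∂ν) ≤ b := by
    rw [← Real.sqrt_sq hb0]
    refine Real.sqrt_le_sqrt ?_
    calc ∫ g, ‖((g : Matrix (Fin N) (Fin N) ℂ) * M * (g : Matrix (Fin N) (Fin N) ℂ) * B).trace‖ ^ 2 ∂ν
        ≤ ∫ _g, b ^ 2 ∂ν := integral_mono (integrable_of_continuous_SUN hwc ν) (integrable_const _)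
            (fun g => pow_le_pow_left₀ (norm_nonneg _) (hw g) 2)
      _ = b ^ 2 := by simp
  have h := integral_normSq_sub_le_sd_centred hN B M hτ ht hW
  have h1 : 0 < τ - 1 := by linarith
  have e : τ * frobNorm M ^ 2 / N + τ ^ 2 * b ^ 2 / 16 + τ ^ 2 * b ^ 2 / (16 * (τ - 1)) =
      τ * frobNorm M ^ 2 / N + τ ^ 3 * b ^ 2 / (16 * (τ - 1)) := by
    field_simp
    ring
  rw [e] at h
  exact h

/-! ### 3. The centred inhabitant of the variance schema and the modulus -/

/-- **THE CENTRED SCHWINGER–DYSON INHABITANT OF THE VARIANCE SCHEMA, every `SU(N)`, `N ≥ 1`, every radius, every `τ > 1`,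
HYPOTHESIS-FREE**: `OneLinkVarianceBound N R (N·(τ + τ³N²R²/(16(τ−1))))`, i.e. for `‖B‖_op ≤ R` and every `Δ`,
`Var_{ν_B}(N Re tr(gΔ)) ≤ N(τ + τ³N²R²/(16(τ−1)))‖Δ‖_F²`.  Proof: `Var(N Re z) ≤ Var(N Re z) + Var(N Im z) = N²(E|z|² − |Ez|²)`,
`integral_normSq_sub_le_sd_centred_frob`, `‖B‖_F ≤ √N‖B‖_op`. [folklore] -/
theorem oneLinkVarianceBound_sdc (hN : 1 ≤ N) (R : ℝ) {τ : ℝ} (hτ : 1 < τ) :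
    OneLinkVarianceBound N R ((N : ℝ) * (τ + τ ^ 3 * (N : ℝ) ^ 2 * R ^ 2 / (16 * (τ - 1)))) := by
  intro B hB Δ
  have hN0 : N ≠ 0 := by omega
  have hNpos : (0 : ℝ) < N := by exact_mod_cast (show 0 < N by omega)
  have h1 : 0 < τ - 1 := by linarith
  set ν : Measure (SUN N) := (haarProbability (SUN N)).tilted
      (fun g => (N : ℝ) * ((g : Matrix (Fin N) (Fin N) ℂ) * B).trace.re) with hν
  have hexpi : Integrable (fun g : SUN N => Real.exp ((N : ℝ) * ((g : Matrix (Fin N) (Fin N) ℂ) * B).trace.re))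
      (haarProbability (SUN N)) :=
    integrable_of_continuous_SUN (Real.continuous_exp.comp (continuous_restrict (contDiff_pot (N : ℝ) B))) _
  haveI : IsProbabilityMeasure ν := isProbabilityMeasure_tilted hexpi
  have hzc' : Continuous fun g : SUN N => ((g : Matrix (Fin N) (Fin N) ℂ) * Δ).trace :=
    (continuous_subtype_val.matrix_mul continuous_const).matrix_trace
  have hzi : Integrable (fun g : SUN N => ((g : Matrix (Fin N) (Fin N) ℂ) * Δ).trace) ν :=
    hzc'.integrable_of_hasCompactSupport (HasCompactSupport.of_compactSpace _)
  set X : SUN N → ℝ := fun g => (N : ℝ) * ((g : Matrix (Fin N) (Fin N) ℂ) * Δ).trace.re with hX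
  set Y : SUN N → ℝ := fun g => (N : ℝ) * ((g : Matrix (Fin N) (Fin N) ℂ) * Δ).trace.im with hY
  have hXc : Continuous X := continuous_const.mul (Complex.continuous_re.comp hzc')
  have hYc : Continuous Y := continuous_const.mul (Complex.continuous_im.comp hzc')
  have hXm : MemLp X 2 ν := hXc.memLp_of_hasCompactSupport (HasCompactSupport.of_compactSpace _)
  have hYm : MemLp Y 2 ν := hYc.memLp_of_hasCompactSupport (HasCompactSupport.of_compactSpace _)
  -- the means
  set μz : ℂ := ∫ g, ((g : Matrix (Fin N) (Fin N) ℂ) * Δ).trace ∂ν with hμz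
  have hre : ∫ g, ((g : Matrix (Fin N) (Fin N) ℂ) * Δ).trace.re ∂ν = μz.re := by
    simpa only [RCLike.re_to_complex] using integral_re hzi
  have him : ∫ g, ((g : Matrix (Fin N) (Fin N) ℂ) * Δ).trace.im ∂ν = μz.im := by
    simpa only [RCLike.im_to_complex] using integral_im hzi
  have hEX : ∫ g, X g ∂ν = (N : ℝ) * μz.re := by simp only [hX]; rw [integral_const_mul, hre]
  have hEY : ∫ g, Y g ∂ν = (N : ℝ) * μz.im := by simp only [hY]; rw [integral_const_mul, him]
  -- second moments add up to `N² E|z|²`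
  have hsq : ∀ g : SUN N, X g ^ 2 + Y g ^ 2 = (N : ℝ) ^ 2 * ‖((g : Matrix (Fin N) (Fin N) ℂ) * Δ).trace‖ ^ 2 := by
    intro g
    simp only [hX, hY]
    rw [Complex.sq_norm, Complex.normSq_apply]
    ring
  have iX2 : Integrable (fun g => X g ^ 2) ν := integrable_of_continuous_SUN (hXc.pow 2) ν
  have iY2 : Integrable (fun g => Y g ^ 2) ν := integrable_of_continuous_SUN (hYc.pow 2) ν
  have hE2 : ∫ g, X g ^ 2 ∂ν + ∫ g, Y g ^ 2 ∂ν =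
      (N : ℝ) ^ 2 * ∫ g, ‖((g : Matrix (Fin N) (Fin N) ℂ) * Δ).trace‖ ^ 2 ∂ν := by
    rw [← integral_add iX2 iY2, ← integral_const_mul]
    exact integral_congr_ae (Filter.Eventually.of_forall hsq)
  have hμ2 : ((N : ℝ) * μz.re) ^ 2 + ((N : ℝ) * μz.im) ^ 2 = (N : ℝ) ^ 2 * ‖μz‖ ^ 2 := by
    rw [Complex.sq_norm, Complex.normSq_apply]; ring
  -- `Var X ≤ Var X + Var Y = N² (E|z|² − |Ez|²)`
  have hVX : Var[X; ν] = ∫ g, X g ^ 2 ∂ν - (∫ g, X g ∂ν) ^ 2 := by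
    rw [variance_eq_sub hXm]; rfl
  have hVY : Var[Y; ν] = ∫ g, Y g ^ 2 ∂ν - (∫ g, Y g ∂ν) ^ 2 := by
    rw [variance_eq_sub hYm]; rfl
  have hVY0 : 0 ≤ Var[Y; ν] := variance_nonneg Y ν
  have hV : Var[X; ν] ≤ (N : ℝ) ^ 2 * (∫ g, ‖((g : Matrix (Fin N) (Fin N) ℂ) * Δ).trace‖ ^ 2 ∂ν - ‖μz‖ ^ 2) := by
    have : Var[X; ν] + Var[Y; ν] =
        (N : ℝ) ^ 2 * (∫ g, ‖((g : Matrix (Fin N) (Fin N) ℂ) * Δ).trace‖ ^ 2 ∂ν - ‖μz‖ ^ 2) := by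
      rw [hVX, hVY, hEX, hEY, mul_sub, ← hE2, ← hμ2]; ring
    linarith
  -- the centred Schwinger–Dyson bound and `‖B‖_F² ≤ N R²`
  have hc := integral_normSq_sub_le_sd_centred_frob hN0 B Δ hτ
  rw [← hν] at hc
  have hb : frobNorm B ≤ Real.sqrt N * R :=
    (frobNorm_le_sqrt_mul_matrixOpNorm B).trans (mul_le_mul_of_nonneg_left hB (Real.sqrt_nonneg _))
  have hb2 : frobNorm B ^ 2 ≤ (N : ℝ) * R ^ 2 := by
    have h := pow_le_pow_left₀ (frobNorm_nonneg B) hb 2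
    rw [mul_pow, Real.sq_sqrt hNpos.le] at h
    exact h
  have hΔ0 := sq_nonneg (frobNorm Δ)
  have hτ3 : 0 ≤ τ ^ 3 / (16 * (τ - 1)) := by positivity
  calc Var[X; ν] ≤ (N : ℝ) ^ 2 * (∫ g, ‖((g : Matrix (Fin N) (Fin N) ℂ) * Δ).trace‖ ^ 2 ∂ν - ‖μz‖ ^ 2) := hV
    _ ≤ (N : ℝ) ^ 2 * (τ * frobNorm Δ ^ 2 / N + τ ^ 3 * (frobNorm B * frobNorm Δ) ^ 2 / (16 * (τ - 1))) :=
        mul_le_mul_of_nonneg_left hc (sq_nonneg _)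
    _ = (N : ℝ) * τ * frobNorm Δ ^ 2 + (N : ℝ) ^ 2 * (τ ^ 3 / (16 * (τ - 1))) * (frobNorm B ^ 2 * frobNorm Δ ^ 2) := by
        field_simp
    _ ≤ (N : ℝ) * τ * frobNorm Δ ^ 2 + (N : ℝ) ^ 2 * (τ ^ 3 / (16 * (τ - 1))) * ((N : ℝ) * R ^ 2 * frobNorm Δ ^ 2) := by
        have := mul_le_mul_of_nonneg_right hb2 hΔ0
        have h2 : 0 ≤ (N : ℝ) ^ 2 * (τ ^ 3 / (16 * (τ - 1))) := by positivity
        nlinarith [mul_le_mul_of_nonneg_left this h2]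
    _ = (N : ℝ) * (τ + τ ^ 3 * (N : ℝ) ^ 2 * R ^ 2 / (16 * (τ - 1))) * frobNorm Δ ^ 2 := by
        field_simp

/-- **THE CENTRED POINCARÉ × SCHWINGER–DYSON ONE-LINK MODULUS, every `SU(N)`, `N ≥ 2`, HYPOTHESIS-FREE**: for `R < 1/2`
and every `τ > 1`, `OneLinkKRModulus N R √((τ + τ³N²R²/(16(τ−1)))/(1/2 − R))` — pub-balaban's door `√(c·v)` with
Bakry–Émery's `c = 1/(N(1/2 − R))` for the test function and the centred Schwinger–Dyson variance for the linear observable.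
[cite: arXiv220412737, Lemma 4.1 and Rem. 1.3] -/
theorem oneLinkKRModulus_pv2 (hN : 2 ≤ N) {R τ : ℝ} (hR : R < 1 / 2) (hτ : 1 < τ) :
    OneLinkKRModulus N R (Real.sqrt ((τ + τ ^ 3 * (N : ℝ) ^ 2 * R ^ 2 / (16 * (τ - 1))) / (1 / 2 - R))) := by
  have hNpos : (0 : ℝ) < N := by exact_mod_cast (show 0 < N by omega)
  have h12 : 0 < 1 / 2 - R := by linarith
  have h1 : 0 < τ - 1 := by linarith
  have hP := oneLinkPoincareSUN_bakryEmery hN hR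
  have hV := oneLinkVarianceBound_sdc (N := N) (by omega) R hτ
  have hc0 : 0 ≤ 1 / ((N : ℝ) * (1 / 2 - R)) := by positivity
  have hv0 : 0 ≤ (N : ℝ) * (τ + τ ^ 3 * (N : ℝ) ^ 2 * R ^ 2 / (16 * (τ - 1))) := by positivity
  have h := oneLinkKRModulus_of_poincare_of_varianceBound hc0 hv0 hP hV
  have e : 1 / ((N : ℝ) * (1 / 2 - R)) * ((N : ℝ) * (τ + τ ^ 3 * (N : ℝ) ^ 2 * R ^ 2 / (16 * (τ - 1)))) =
      (τ + τ ^ 3 * (N : ℝ) ^ 2 * R ^ 2 / (16 * (τ - 1))) / (1 / 2 - R) := by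
    field_simp
  rw [e] at h
  exact h

/-- **Rational envelope** (the shape the row files consume): for `N ≥ 2`, `R < 1/2`, `τ > 1` and `K ≥ 0` with
`K²(1/2 − R) ≥ τ + τ³N²R²/(16(τ−1))`, `OneLinkKRModulus N R K`. [folklore] -/
theorem oneLinkKRModulus_pv2_of_le (hN : 2 ≤ N) {R τ K : ℝ} (hR : R < 1 / 2) (hτ : 1 < τ) (hK0 : 0 ≤ K)
    (hK : τ + τ ^ 3 * (N : ℝ) ^ 2 * R ^ 2 / (16 * (τ - 1)) ≤ K ^ 2 * (1 / 2 - R)) : OneLinkKRModulus N R K := by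
  have h12 : 0 < 1 / 2 - R := by linarith
  refine oneLinkKRModulus_mono_const (oneLinkKRModulus_pv2 hN hR hτ) ?_
  rw [← Real.sqrt_sq hK0]
  refine Real.sqrt_le_sqrt ?_
  rw [div_le_iff₀ h12]
  exact hK

/-! ### 4. `SU(3)` forms with literal constants -/

/-- `SU(3)`: the centred Schwinger–Dyson variance bound with a rational constant: for `τ > 1` and
`16(τ−1)·3τ + 27τ³R²·… `, precisely `48τ(τ−1) + 27τ³R² ≤ 16(τ−1)·v` ⇒ `OneLinkVarianceBound 3 R v`. [folklore] -/
theorem su3_oneLinkVarianceBound_sdc_of_le {R τ v : ℝ} (hτ : 1 < τ)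
    (hv : 48 * τ * (τ - 1) + 27 * τ ^ 3 * R ^ 2 ≤ 16 * (τ - 1) * v) : OneLinkVarianceBound 3 R v := by
  have h1 : 0 < τ - 1 := by linarith
  have h := oneLinkVarianceBound_sdc (N := 3) (by norm_num) R hτ
  refine h.mono le_rfl ?_
  have e : ((3 : ℕ) : ℝ) * (τ + τ ^ 3 * ((3 : ℕ) : ℝ) ^ 2 * R ^ 2 / (16 * (τ - 1))) =
      (48 * τ * (τ - 1) + 27 * τ ^ 3 * R ^ 2) / (16 * (τ - 1)) := by
    push_cast
    field_simp
    ring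
  rw [e, div_le_iff₀ (by positivity)]
  linarith

/-- `SU(3)`: the centred modulus with a rational constant: `R < 1/2`, `τ > 1`, `K ≥ 0` and
`16τ(τ−1) + 9τ³R² ≤ 16(τ−1)·K²(1/2 − R)` ⇒ `OneLinkKRModulus 3 R K`. [folklore] -/
theorem su3_oneLinkKRModulus_pv2_of_le {R τ K : ℝ} (hR : R < 1 / 2) (hτ : 1 < τ) (hK0 : 0 ≤ K)
    (hK : 16 * τ * (τ - 1) + 9 * τ ^ 3 * R ^ 2 ≤ 16 * (τ - 1) * (K ^ 2 * (1 / 2 - R))) : OneLinkKRModulus 3 R K := by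
  have h1 : 0 < τ - 1 := by linarith
  refine oneLinkKRModulus_pv2_of_le (N := 3) (by norm_num) hR hτ hK0 ?_
  have e : τ + τ ^ 3 * ((3 : ℕ) : ℝ) ^ 2 * R ^ 2 / (16 * (τ - 1)) = (16 * τ * (τ - 1) + 9 * τ ^ 3 * R ^ 2) / (16 * (τ - 1)) := by
    push_cast
    field_simp
    ring
  rw [e, div_le_iff₀ (by positivity)]
  linarith

end Summit.Ventures.YMGap.OneLinkVarianceSDC

end
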